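import Summits.QuantumFields.BalabanUV.Beta.WilsonBiStencilWardZ

/-!
# The (T2-S₂) Wilson table law at level 0 in THE EXACT SHAPE OF THE hW SOCKET ROWS `hS₂` / `hS₂''` of
# `KernelWardSymAssembly.divW_W2SymOfK_eq_conjV_add_residuals`, with remainder ZERO — both background slots
# (β sub-cell, row D1, (L4) W-side, Ward twin of (W-LET-S₂)₀; D1 formalisation swarm seat `b2b-balaban-beta-d1-formalise-leaf-09`, gen 4;
# CLAIM «D1-hW-L4-W22-TABLE-WARD», file 5)

HONEST FRAMING (cell charter, verbatim): «discharging `BetaPertH` makes Bałaban's UV stability UNCONDITIONAL — a real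
constructive-QFT result; it is NOT the continuum limit and NOT the Clay problem.»  HONEST DEPENDENCY (cell records, verbatim):
«continuum YM on T⁴ ⇐ BetaPertH ∧ nine spine estimates (0/9 proved); BetaPertH ⇐ (D1) ∧ (D4) ∧ CAP+tail; G-an2-4 gates asym, D1 and
NE2/3/4.»  DERIVED cell leaf: finite algebra over `ℤ^{d+1}`, nothing cited — every statement is kernel-proved here ([folklore]); no `[cite:]`
tag, no `def`, no `def … : Prop`.  By itself this file instantiates NO binder of the β-function wall.  NOT D1, NOT `BetaPertH`, NOT continuum,
NOT Clay.
ABSOLUTE RULE (cell charter, verbatim): «No internally-minted statement may enter as a cited fact. Every hypothesis is either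
kernel-proved in this package or a verbatim quotation of a PUBLISHED theorem with page reference. The manuscript(s) under audit are
NOT citable for their own disputed steps — they are the thing under adjudication; programme-internal (2001/route/tribunal) claims are
never citable.»

## What

File 4 (`WilsonBiStencilWardZ.divV_wilsonW₂_wsym22_eq_conjV`) is the law for the divergence in the FIRST background bond of an3's Wilson
bi-stencil with the symmetrised colour-traced table `wsym22 N`.  §1: that family is PAIR-SYMMETRIC and LEG-SYMMETRIC (an3's
`wilsonW₂_symTab_swap` / `wilsonW₂_symTab_transpose` read through `symTab_w22`), so (§2) the divergence in the SECOND background bond obeys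
the same law (`divV_wilsonW₂_wsym22_snd_eq_conjV`, block form `sum_divV_wilsonW₂_wsym22_snd_eq_conjV`).  §3 writes both in the literal
shape of the hW socket rows of leaf-10's `KernelWardSymAssembly.divW_W2SymOfK_eq_conjV_add_residuals` for the WILSON LETTER of the level-0
bi-table — `S₂ := wilsonW₂ d (wsym22 N)`, `S := c • wilsonA d`, `X y := diagK (ξ • Σ_{v ∈ box} legInd ρ (L•y + toSite v))`, blocking `L`,
any root `ρ` — under the ONE scalar lock `cH · 4N² = c · ξ`:
**`hS₂_wilson`**: `cH • Σ_{v ∈ box} divV (fun κ u ↦ S₂ κ u κ′ u′) (L•y + toSite v) = comp (S κ′ u′) (X y) − comp (X y) (S κ′ u′) + 0`,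
**`hS₂''_wilson`**: `cH • Σ_{v ∈ box} divV (S₂ κ u) (L•y + toSite v) = comp (S κ u) (X y) − comp (X y) (S κ u) + 0`
— i.e. the remainder tables `R`, `R″` of those rows are ZERO for the Wilson letter (so their (R-loc)/(R-par) sockets are trivial).
NOT HERE: the border letter `vh₂S` (an1's (W-0B)), the mixed table law (W-LET-M₂), the pin of `T`/`cE₂` ((R45)/(P6)), the assembly.
Provenance: pub-balaban β sub-cell, D1 formalisation swarm, unit `b2b-balaban-beta-d1-formalise-leaf-09` gen 4, 2026-08-20 (v1); over file 4,
an3's `WilsonVertex2Sym` and an2's `KernelReflection.comp_smul_left/right` BY NAME; no existing file touched.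
-/

namespace Summit.QuantumFields.BalabanUV.Beta.WilsonBiStencilWardSocket

open Finset
open scoped BigOperators
open Literature.MathematicalPhysics.QuantumFieldTheory.Balaban1983to89
open Literature.MathematicalPhysics.QuantumFieldTheory.Balaban1983to89.Beta
open ColourTrace (Complete TrOrthonormal)
open PlaquetteVertex2Trace (w22)
open WilsonVertex2Sym (symTab symTab_w22 wsym22 wilsonW₂_symTab_swap wilsonW₂_symTab_transpose)
open WilsonBiStencil (wilsonW₂)
open StepJetData (wilsonA)
open ExpKernelCalculus (MKer comp)
open OneStepResolventKernel (Fib)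
open KernelWard (divV)
open AffineAveraging (box toSite)
open Summit.QuantumFields.BalabanUV.Beta.ChartConjugation (conjV)
open Summit.QuantumFields.BalabanUV.Beta.BorderedHessian (diagK)
open Summit.QuantumFields.BalabanUV.Beta.AveragingWardRootedStencils (legInd)
open Summit.QuantumFields.BalabanUV.Beta.WilsonBiStencilWardZ (divV_wilsonW₂_wsym22_eq_conjV sum_divV_wilsonW₂_wsym22_eq_conjV)

variable {d : ℕ} {N : ℕ}

/-! ## §1 Pair and leg symmetry of the `wsym22` family -/

/-- [folklore] **PAIR SYMMETRY**: `wilsonW₂ d (wsym22 N) κ′ u′ κ u = wilsonW₂ d (wsym22 N) κ u κ′ u′`. -/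
theorem wilsonW₂_wsym22_swap (κ : Fin (d + 1)) (u : Fin (d + 1) → ℤ) (κ' : Fin (d + 1)) (u' : Fin (d + 1) → ℤ) :
    wilsonW₂ d (wsym22 N) κ' u' κ u = wilsonW₂ d (wsym22 N) κ u κ' u' := by
  rw [← symTab_w22]
  exact wilsonW₂_symTab_swap (w22 N) κ u κ' u'

/-- [folklore] **LEG SYMMETRY**: `wilsonW₂ d (wsym22 N) κ u κ′ u′ z x b a = wilsonW₂ d (wsym22 N) κ u κ′ u′ x z a b`. -/
theorem wilsonW₂_wsym22_transpose (κ : Fin (d + 1)) (u : Fin (d + 1) → ℤ) (κ' : Fin (d + 1)) (u' : Fin (d + 1) → ℤ)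
    (x z : Fin (d + 1) → ℤ) (a b : Fib d) :
    wilsonW₂ d (wsym22 N) κ u κ' u' z x b a = wilsonW₂ d (wsym22 N) κ u κ' u' x z a b := by
  rw [← symTab_w22]
  exact wilsonW₂_symTab_transpose (w22 N) κ u κ' u' x z a b

/-- [folklore] the second-slot family at a fixed first bond IS the first-slot family at that bond as second bond. -/
theorem wilsonW₂_wsym22_snd_eq (κ : Fin (d + 1)) (u : Fin (d + 1) → ℤ) :
    wilsonW₂ d (wsym22 N) κ u = fun κ' u' => wilsonW₂ d (wsym22 N) κ' u' κ u := by
  funext κ' u'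
  exact wilsonW₂_wsym22_swap κ' u' κ u

/-! ## §2 The law for the divergence in the second background bond -/

section Second

variable {C : Type*} [Fintype C] [DecidableEq C] {τ : C → Matrix (Fin N) (Fin N) ℂ}

/-- [folklore] **SECOND-SLOT LAW**: `divV (wilsonW₂ d (wsym22 N) κ u) u₀ = (4·N²) • conjV (wilsonA d κ u) (diagK (legInd ρ u₀))`. -/
theorem divV_wilsonW₂_wsym22_snd_eq_conjV (hτ : Complete τ) (ho : TrOrthonormal τ) (hN : N ≠ 0) (c : C) (ρ : Fin (d + 1) → ℤ)
    (κ : Fin (d + 1)) (u u₀ : Fin (d + 1) → ℤ) :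
    divV (wilsonW₂ d (wsym22 N) κ u) u₀ = (4 * (N : ℝ) ^ 2) • conjV (wilsonA d κ u) (diagK (legInd ρ u₀)) := by
  rw [wilsonW₂_wsym22_snd_eq]
  exact divV_wilsonW₂_wsym22_eq_conjV hτ ho hN c ρ u κ u₀

/-- [folklore] its block (finitely smeared) form. -/
theorem sum_divV_wilsonW₂_wsym22_snd_eq_conjV (hτ : Complete τ) (ho : TrOrthonormal τ) (hN : N ≠ 0) (c : C) {ι : Type*} (s : Finset ι)
    (U : ι → Fin (d + 1) → ℤ) (ρ : Fin (d + 1) → ℤ) (κ : Fin (d + 1)) (u : Fin (d + 1) → ℤ) :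
    ∑ i ∈ s, divV (wilsonW₂ d (wsym22 N) κ u) (U i) = (4 * (N : ℝ) ^ 2) • conjV (wilsonA d κ u) (diagK (∑ i ∈ s, legInd ρ (U i))) := by
  rw [wilsonW₂_wsym22_snd_eq]
  exact sum_divV_wilsonW₂_wsym22_eq_conjV hτ ho hN c s U ρ u κ

end Second

/-! ## §3 The socket rows with their scalar lock -/

section Socket

variable {C : Type*} [Fintype C] [DecidableEq C] {τ : C → Matrix (Fin N) (Fin N) ℂ}

omit [Fintype C] [DecidableEq C] in
/-- [folklore] the algebra of the rows: under the lock `cH·w = c·ξ`, `cH • w • conjV A (diagK G) = comp (c • A) (diagK (ξ • G)) − comp (diagK (ξ • G)) (c • A) + 0`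
for a finitely smeared leg indicator `G`. -/
theorem row_of_conjV {ι : Type*} (s : Finset ι) (g : ι → (Fin (d + 1) → ℤ) → Fib d → ℝ) (A : MKer (d + 1) (Fib d)) {cH w c ξ : ℝ}
    (hlock : cH * w = c * ξ) :
    cH • w • conjV A (diagK (∑ i ∈ s, g i)) =
      comp (c • A) (diagK (ξ • ∑ i ∈ s, g i)) - comp (diagK (ξ • ∑ i ∈ s, g i)) (c • A) + 0 := by
  have hd : diagK (ξ • ∑ i ∈ s, g i) = ξ • diagK (∑ i ∈ s, g i) := by
    funext x z a b
    simp only [BorderedHessian.diagK_apply, Pi.smul_apply, smul_eq_mul]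
    split_ifs <;> simp
  rw [add_zero, hd]
  unfold ChartConjugation.conjV
  simp only [KernelReflection.comp_smul_left, KernelReflection.comp_smul_right, smul_sub, smul_smul]
  rw [hlock, mul_comm ξ c]

/-- [folklore] **THE ROW `hS₂` FOR THE WILSON LETTER, REMAINDER ZERO**: with `S₂ = wilsonW₂ d (wsym22 N)`, `S = c • wilsonA d`,
`X y = diagK (ξ • Σ_{v ∈ box} legInd ρ (L•y + toSite v))` and the lock `cH·4N² = c·ξ`:
`cH • Σ_{v ∈ box} divV (κ u ↦ S₂ κ u κ′ u′) (L•y + toSite v) = comp (S κ′ u′) (X y) − comp (X y) (S κ′ u′) + 0`. -/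
theorem hS₂_wilson (hτ : Complete τ) (ho : TrOrthonormal τ) (hN : N ≠ 0) (cc : C) (L : ℕ) (ρ : Fin (d + 1) → ℤ) {cH c ξ : ℝ}
    (hlock : cH * (4 * (N : ℝ) ^ 2) = c * ξ) (y : Fin (d + 1) → ℤ) (κ' : Fin (d + 1)) (u' : Fin (d + 1) → ℤ) :
    cH • ∑ v ∈ box (d + 1) L, divV (fun κ u => wilsonW₂ d (wsym22 N) κ u κ' u') ((L : ℤ) • y + toSite v) =
      comp (c • wilsonA d κ' u') (diagK (ξ • ∑ v ∈ box (d + 1) L, legInd ρ ((L : ℤ) • y + toSite v)))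
        - comp (diagK (ξ • ∑ v ∈ box (d + 1) L, legInd ρ ((L : ℤ) • y + toSite v))) (c • wilsonA d κ' u') + 0 := by
  rw [sum_divV_wilsonW₂_wsym22_eq_conjV hτ ho hN cc (box (d + 1) L) (fun v => (L : ℤ) • y + toSite v) ρ u' κ']
  exact row_of_conjV (box (d + 1) L) (fun v => legInd ρ ((L : ℤ) • y + toSite v)) (wilsonA d κ' u') hlock

/-- [folklore] **THE ROW `hS₂''` FOR THE WILSON LETTER, REMAINDER ZERO** (divergence in the second background bond):
`cH • Σ_{v ∈ box} divV (S₂ κ u) (L•y + toSite v) = comp (S κ u) (X y) − comp (X y) (S κ u) + 0`. -/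
theorem hS₂''_wilson (hτ : Complete τ) (ho : TrOrthonormal τ) (hN : N ≠ 0) (cc : C) (L : ℕ) (ρ : Fin (d + 1) → ℤ) {cH c ξ : ℝ}
    (hlock : cH * (4 * (N : ℝ) ^ 2) = c * ξ) (y : Fin (d + 1) → ℤ) (κ : Fin (d + 1)) (u : Fin (d + 1) → ℤ) :
    cH • ∑ v ∈ box (d + 1) L, divV (wilsonW₂ d (wsym22 N) κ u) ((L : ℤ) • y + toSite v) =
      comp (c • wilsonA d κ u) (diagK (ξ • ∑ v ∈ box (d + 1) L, legInd ρ ((L : ℤ) • y + toSite v)))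
        - comp (diagK (ξ • ∑ v ∈ box (d + 1) L, legInd ρ ((L : ℤ) • y + toSite v))) (c • wilsonA d κ u) + 0 := by
  rw [sum_divV_wilsonW₂_wsym22_snd_eq_conjV hτ ho hN cc (box (d + 1) L) (fun v => (L : ℤ) • y + toSite v) ρ κ u]
  exact row_of_conjV (box (d + 1) L) (fun v => legInd ρ ((L : ℤ) • y + toSite v)) (wilsonA d κ u) hlock

end Socket

end Summit.QuantumFields.BalabanUV.Beta.WilsonBiStencilWardSocket
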